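import Literature.NumberTheory.LFunctions.Zhang2022.DetectorEntangledMomentSOS
import Literature.NumberTheory.LFunctions.Zhang2022.DetectorEntangledMomentSOSConfluent

/-!
# Zhang (2022), programme F-S3 (cell landau-siegel §E, registry E-102 HEAD 1): the four SOS moment identities for
# EVERY real node configuration — hypothesis-minimal wrappers over the distinct and confluent leaves

Y. Zhang, *Discrete mean estimates and the Landau–Siegel zero*, arXiv:2211.02515v1 [Zhang2022LandauSiegel] — an
unrefereed manuscript under adjudication. **WHAT THIS IS NOT: not a claim about Theorems 1–2 of arXiv:2211.02515,
about Landau–Siegel zeros, or about Parity. «The programme SEARCHES and TYPES; no claim about Landau–Siegel zeros,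
Theorems 1–2 of arXiv:2211.02515 or a repaired Margin232 until a kernel theorem says so.»**

`DetectorEntangledMomentSOS` (seat ls-barrier-p2) proves the four scalar identities (i)–(iv) of the sum-of-squares
decomposition of `π·Re Det.entangledMain` at pairwise DISTINCT nodes `(a,x,y)`, in the vocabulary `Det.halfExp`,
`Det.sosKappa`, `Det.sosSigma`; `DetectorEntangledMomentSOSConfluent` (seat ls-num-2) proves them at every CONFLUENT
configuration by the `dd2` branches, with the coefficients expanded over `Det.halfUnit`. This file glues the two into
statements with the FEWEST hypotheses the objects allow, in ls-barrier-p2's vocabulary, so the assembly over a palette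
(ordered pairs `(b_j, b_l)`, repeats and anchor coincidences allowed) needs no case analysis beyond «is `b_j = a`?»:

* `halfUnit_eq_halfExp` — the bridge `Det.halfUnit b m = Det.halfExp (b m)`;
* `momentSOS_gamma_gamma_all (a x y)` — (iv) with NO hypothesis (κ has no singularity);
* `momentSOS_omega_gamma_of_ne (hax : a ≠ x) (y)`, `momentSOS_gamma_omega_of_ne (hay : a ≠ y) (x)`,
  `momentSOS_omega_omega_of_ne (hax) (hay)` — (ii), (iii), (i) through `sosSigma` whenever the σ-argument is off the
  anchor, ALL coincidences of the other node allowed;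
* `momentSOS_omega_gamma_anchor (a y)`, `momentSOS_gamma_omega_anchor (a x)`, `momentSOS_omega_omega_anchorLeft'`,
  `…_anchorRight'`, `…_anchorAll'` — the σ-argument ON the anchor, with the removable value
  `σ(a,a) = 1 + iπa − E_a²` written in `halfExp` (recall `Det.sosSigma a a = −E_a²` by `x/0 = 0` is NOT that value).

Pure case analysis + rewriting; standard axioms; 0 defs; 0 named facts.
-/

noncomputable section

open Complex Real ComplexConjugate

namespace Literature.NumberTheory.LFunctions.Zhang2022

namespace Det

/-- The two unit-exponential spellings agree: `halfUnit b m = halfExp (b m) = e^{iπ b_m/2}`.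
[cite: Zhang2022LandauSiegel, Lemma 5.2 p.10] -/
theorem halfUnit_eq_halfExp (b : Fin 3 → ℝ) (m : Fin 3) : halfUnit b m = halfExp (b m) := by
  unfold halfUnit halfExp
  congr 1
  push_cast
  ring

variable {a x y : ℝ}

/-- **(iv) for EVERY real `(a, x, y)`** (repeats and anchor coincidences included).
[cite: Zhang2022LandauSiegel, Prop 7.1 p.44 with (8.11)–(8.23)] -/
theorem momentSOS_gamma_gamma_all (a x y : ℝ) :
    ((x * y * (x + y) : ℝ) : ℂ) * (ddM0 ![a, x, y] - conj (ddM0 ![a, x, y]))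
      - 2 * ((x * y : ℝ) : ℂ) * (ddMs ![a, x, y] - conj (ddMs ![a, x, y]))
      + ((x * y * (y - x) : ℝ) : ℂ) * (ddM0 ![a, x, y] + conj (ddM0 ![a, x, y]))
      + 2 * ((x : ℂ) * ddMn ![a, x, y] - (y : ℂ) * conj (ddMn ![a, x, y]))
    = 2 * (halfExp a - (halfExp a)⁻¹) * sosKappa x * conj (sosKappa y) := by
  rw [sosKappa_eq, conj_sosKappa]
  by_cases hax : a = x
  · subst hax
    by_cases hay : a = y
    · subst hay
      simpa only [halfUnit_eq_halfExp, Matrix.cons_val_zero] using momentSOS_gamma_gamma_anchorAll a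
    · simpa only [halfUnit_eq_halfExp, Matrix.cons_val_zero, Matrix.cons_val_two, Matrix.tail_cons,
        Matrix.head_cons] using momentSOS_gamma_gamma_anchorLeft a y hay
  · by_cases hay : a = y
    · subst hay
      simpa only [halfUnit_eq_halfExp, Matrix.cons_val_zero, Matrix.cons_val_one, Matrix.head_cons]
        using momentSOS_gamma_gamma_anchorRight a x hax
    · by_cases hxy : x = y
      · subst hxy
        simpa only [halfUnit_eq_halfExp, Matrix.cons_val_zero, Matrix.cons_val_one, Matrix.head_cons]
          using momentSOS_gamma_gamma_diag a x hax
      · rw [momentSOS_gamma_gamma hax hay hxy, sosKappa_eq, conj_sosKappa]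

/-- **(ii) for `x ≠ a` and EVERY real `y`** (`y = x`, `y = a` included).
[cite: Zhang2022LandauSiegel, Prop 7.1 p.44 with (8.11)–(8.23)] -/
theorem momentSOS_omega_gamma_of_ne (hax : a ≠ x) (y : ℝ) :
    2 * (y : ℂ) * (ddMs ![a, x, y] - conj (ddMs ![a, x, y]))
      - ((y * (a + x + y) : ℝ) : ℂ) * (ddM0 ![a, x, y] - conj (ddM0 ![a, x, y]))
      - 2 * ddMn ![a, x, y]
      + ((y * (a + x - y) : ℝ) : ℂ) * (ddM0 ![a, x, y] + conj (ddM0 ![a, x, y]))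
    = 2 * sosSigma a x * conj (sosKappa y) := by
  rw [sosSigma_eq, conj_sosKappa]
  by_cases hay : a = y
  · subst hay
    simpa only [halfUnit_eq_halfExp, Matrix.cons_val_zero, Matrix.cons_val_one, Matrix.head_cons]
      using momentSOS_omega_gamma_anchorRight a x hax
  · by_cases hxy : x = y
    · subst hxy
      simpa only [halfUnit_eq_halfExp, Matrix.cons_val_zero, Matrix.cons_val_one, Matrix.head_cons]
        using momentSOS_omega_gamma_diag a x hax
    · rw [momentSOS_omega_gamma hax hay hxy, sosSigma_eq, conj_sosKappa]

/-- **(iii) for `y ≠ a` and EVERY real `x`** (`x = y`, `x = a` included).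
[cite: Zhang2022LandauSiegel, Prop 7.1 p.44 with (8.11)–(8.23)] -/
theorem momentSOS_gamma_omega_of_ne (hay : a ≠ y) (x : ℝ) :
    -(2 * (x : ℂ)) * (ddMs ![a, x, y] - conj (ddMs ![a, x, y]))
      + ((x * (a + x + y) : ℝ) : ℂ) * (ddM0 ![a, x, y] - conj (ddM0 ![a, x, y]))
      - 2 * conj (ddMn ![a, x, y])
      + ((x * (a + y - x) : ℝ) : ℂ) * (ddM0 ![a, x, y] + conj (ddM0 ![a, x, y]))
    = 2 * conj (sosSigma a y) * sosKappa x := by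
  rw [conj_sosSigma, sosKappa_eq]
  by_cases hax : a = x
  · subst hax
    simpa only [halfUnit_eq_halfExp, Matrix.cons_val_zero, Matrix.cons_val_two, Matrix.tail_cons, Matrix.head_cons]
      using momentSOS_gamma_omega_anchorLeft a y hay
  · by_cases hxy : x = y
    · subst hxy
      simpa only [halfUnit_eq_halfExp, Matrix.cons_val_zero, Matrix.cons_val_one, Matrix.head_cons]
        using momentSOS_gamma_omega_diag a x hax
    · rw [momentSOS_gamma_omega hax hay hxy, conj_sosSigma, sosKappa_eq]

/-- **(i) for `x ≠ a`, `y ≠ a` and EVERY such pair** (`y = x` included).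
[cite: Zhang2022LandauSiegel, Prop 7.1 p.44 with (8.11)–(8.23)] -/
theorem momentSOS_omega_omega_of_ne (hax : a ≠ x) (hay : a ≠ y) :
    (halfExp a - (halfExp a)⁻¹) *
        (-((a + x + y : ℝ) : ℂ) * (ddM0 ![a, x, y] - conj (ddM0 ![a, x, y]))
          + 2 * (ddMs ![a, x, y] - conj (ddMs ![a, x, y]))
          - ((y - x : ℝ) : ℂ) * (ddM0 ![a, x, y] + conj (ddM0 ![a, x, y])))
    = 2 * sosSigma a x * conj (sosSigma a y)
      + (a : ℂ) * (halfExp a + (halfExp a)⁻¹) * (ddM0 ![a, x, y] + conj (ddM0 ![a, x, y])) := by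
  by_cases hxy : x = y
  · subst hxy
    rw [conj_sosSigma, sosSigma_eq]
    simpa only [halfUnit_eq_halfExp, Matrix.cons_val_zero, Matrix.cons_val_one, Matrix.head_cons]
      using momentSOS_omega_omega_diag a x hax
  · exact momentSOS_omega_omega hax hay hxy

/-! ### The σ-argument on the anchor: the removable value `σ(a,a) = 1 + iπa − E_a²` -/

/-- **(ii) at `x = a`, EVERY real `y`.** [cite: Zhang2022LandauSiegel, Prop 7.1 p.44 with (8.11)–(8.23)] -/
theorem momentSOS_omega_gamma_anchor (a y : ℝ) :
    2 * (y : ℂ) * (ddMs ![a, a, y] - conj (ddMs ![a, a, y]))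
      - ((y * (a + a + y) : ℝ) : ℂ) * (ddM0 ![a, a, y] - conj (ddM0 ![a, a, y]))
      - 2 * ddMn ![a, a, y]
      + ((y * (a + a - y) : ℝ) : ℂ) * (ddM0 ![a, a, y] + conj (ddM0 ![a, a, y]))
    = 2 * (1 + I * π * (a : ℂ) - halfExp a * halfExp a) * conj (sosKappa y) := by
  rw [conj_sosKappa]
  by_cases hay : a = y
  · subst hay
    simpa only [halfUnit_eq_halfExp, Matrix.cons_val_zero] using momentSOS_omega_gamma_anchorAll a
  · simpa only [halfUnit_eq_halfExp, Matrix.cons_val_zero, Matrix.cons_val_two, Matrix.tail_cons, Matrix.head_cons]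
      using momentSOS_omega_gamma_anchorLeft a y hay

/-- **(iii) at `y = a`, EVERY real `x`.** [cite: Zhang2022LandauSiegel, Prop 7.1 p.44 with (8.11)–(8.23)] -/
theorem momentSOS_gamma_omega_anchor (a x : ℝ) :
    -(2 * (x : ℂ)) * (ddMs ![a, x, a] - conj (ddMs ![a, x, a]))
      + ((x * (a + x + a) : ℝ) : ℂ) * (ddM0 ![a, x, a] - conj (ddM0 ![a, x, a]))
      - 2 * conj (ddMn ![a, x, a])
      + ((x * (a + a - x) : ℝ) : ℂ) * (ddM0 ![a, x, a] + conj (ddM0 ![a, x, a]))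
    = 2 * (1 - I * π * (a : ℂ) - (halfExp a)⁻¹ * (halfExp a)⁻¹) * sosKappa x := by
  rw [sosKappa_eq]
  by_cases hax : a = x
  · subst hax
    simpa only [halfUnit_eq_halfExp, Matrix.cons_val_zero] using momentSOS_gamma_omega_anchorAll a
  · simpa only [halfUnit_eq_halfExp, Matrix.cons_val_zero, Matrix.cons_val_one, Matrix.head_cons]
      using momentSOS_gamma_omega_anchorRight a x hax

/-- **(i) at `x = a ≠ y`.** [cite: Zhang2022LandauSiegel, Prop 7.1 p.44 with (8.11)–(8.23)] -/
theorem momentSOS_omega_omega_anchorLeft' (a y : ℝ) (hay : a ≠ y) :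
    (halfExp a - (halfExp a)⁻¹) *
        (-((a + a + y : ℝ) : ℂ) * (ddM0 ![a, a, y] - conj (ddM0 ![a, a, y]))
          + 2 * (ddMs ![a, a, y] - conj (ddMs ![a, a, y]))
          - ((y - a : ℝ) : ℂ) * (ddM0 ![a, a, y] + conj (ddM0 ![a, a, y])))
    = 2 * (1 + I * π * (a : ℂ) - halfExp a * halfExp a) * conj (sosSigma a y)
      + (a : ℂ) * (halfExp a + (halfExp a)⁻¹) * (ddM0 ![a, a, y] + conj (ddM0 ![a, a, y])) := by
  rw [conj_sosSigma]
  simpa only [halfUnit_eq_halfExp, Matrix.cons_val_zero, Matrix.cons_val_two, Matrix.tail_cons, Matrix.head_cons]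
    using momentSOS_omega_omega_anchorLeft a y hay

/-- **(i) at `y = a ≠ x`.** [cite: Zhang2022LandauSiegel, Prop 7.1 p.44 with (8.11)–(8.23)] -/
theorem momentSOS_omega_omega_anchorRight' (a x : ℝ) (hax : a ≠ x) :
    (halfExp a - (halfExp a)⁻¹) *
        (-((a + x + a : ℝ) : ℂ) * (ddM0 ![a, x, a] - conj (ddM0 ![a, x, a]))
          + 2 * (ddMs ![a, x, a] - conj (ddMs ![a, x, a]))
          - ((a - x : ℝ) : ℂ) * (ddM0 ![a, x, a] + conj (ddM0 ![a, x, a])))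
    = 2 * sosSigma a x * (1 - I * π * (a : ℂ) - (halfExp a)⁻¹ * (halfExp a)⁻¹)
      + (a : ℂ) * (halfExp a + (halfExp a)⁻¹) * (ddM0 ![a, x, a] + conj (ddM0 ![a, x, a])) := by
  rw [sosSigma_eq]
  simpa only [halfUnit_eq_halfExp, Matrix.cons_val_zero, Matrix.cons_val_one, Matrix.head_cons]
    using momentSOS_omega_omega_anchorRight a x hax

/-- **(i) at `x = y = a`.** [cite: Zhang2022LandauSiegel, Prop 7.1 p.44 with (8.11)–(8.23)] -/
theorem momentSOS_omega_omega_anchorAll' (a : ℝ) :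
    (halfExp a - (halfExp a)⁻¹) *
        (-((a + a + a : ℝ) : ℂ) * (ddM0 ![a, a, a] - conj (ddM0 ![a, a, a]))
          + 2 * (ddMs ![a, a, a] - conj (ddMs ![a, a, a]))
          - ((a - a : ℝ) : ℂ) * (ddM0 ![a, a, a] + conj (ddM0 ![a, a, a])))
    = 2 * (1 + I * π * (a : ℂ) - halfExp a * halfExp a) * (1 - I * π * (a : ℂ) - (halfExp a)⁻¹ * (halfExp a)⁻¹)
      + (a : ℂ) * (halfExp a + (halfExp a)⁻¹) * (ddM0 ![a, a, a] + conj (ddM0 ![a, a, a])) := by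
  simpa only [halfUnit_eq_halfExp, Matrix.cons_val_zero] using momentSOS_omega_omega_anchorAll a

end Det

end Literature.NumberTheory.LFunctions.Zhang2022
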